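/-
Copyright (c) 2026 the pub-hodgecm-mathlib formalisation cell (harness21).  Prover seat hodgecm-mathlib-K2E4-p14 (g7), Track B ∕ K2-LIT, h413 =
`stmt-HodgeConjecture-24833`, line `K2_E1_TraceFormulaBeta`, road (ρ2) «G7 PROPER», file (R-d2) (dealer K2E1-plan (g5), RULINGS 09:28:55Z ∕ 09:36:34Z «(R-d2) is yours»):
«cusp forms have mean zero» on `U(1,1)(L⁺)∖U(1,1)(𝔸_{L⁺})` modulo the `𝔛`-SIDE SUP-DECAY LETTER `hK1X` of the K1 engine (the natural interface with K1-L²'s `𝔛`-wrapper).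
-/
import Summits.HodgeConjecture.HodgeConjecture.Theorems.K2E1CuspFormsMeanZeroCMTwo                  -- ★ (R-d1) p859033 (this seat): `hmean_cm_two_of_smoothing_decay (hsm)`, `integral_orbitalSmoothing_eq_mul`, continuity
import Summits.HodgeConjecture.HodgeConjecture.Theorems.K2E1BLHeckeOperatorHXU2                    -- ★ P3 FILE C pt 1 p858962 (K2E1-p09 g6): `measurable_supHeight` (leaf of record), `supHeight_pos`
import Summits.HodgeConjecture.HodgeConjecture.Theorems.K2E1BLEisensteinInWeightedSpaceU2Weights   -- ★ P7 FILE C p858854 (K2E4-p23 g0): `exists_pos_forall_le_supHeight_cm` (`c₀ ≤ w₁`)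
import HarnessLib

/-!
# K2·E1 — `K2E1CuspFormsMeanZeroOfSupDecayCMTwo` (road (ρ2) «G7 PROPER», file (R-d2)): «CUSP FORMS HAVE MEAN ZERO» FOR `U(1,1)_{L∕L⁺}` MODULO THE `𝔛`-SIDE K1 SUP-DECAY
# LETTER `hK1X` — the decay letter `hsm` of ★ (R-d1) from a sup-norm decay `‖S_ηS_ηφ(x)‖ ≤ C·‖φ‖₂·w₁(x)^{−m}`, `m ≥ A`

Track B ∕ K2-LIT, crux h413 = `stmt-HodgeConjecture-24833`, route of record `HCCMUnconditional`; cell `hodgecm-mathlib`, squad K2, ENGINE E1.  Prover seat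
`hodgecm-mathlib-K2E4-p14` (g7).  THEOREMS ONLY (no `def`, no `instance`, no notation, no named-fact hypothesis, no `sorry`); lane `--supports stmt-HodgeConjecture-24833
--as helper` (count-neutral).  Closes no socket.

THE POINT.  ★ (R-d1) `hmean_cm_two_of_smoothing_decay` proves `∀ φ ∈ cuspForms μ 𝔓, ∫_X φ dμ = 0` modulo `hsm : ∀ φ ∈ cuspForms, Integrable (w₁^A·‖S_η S_Θ φ‖) μ`.  The K1 engine
(★ p858893 `exists_norm_orbitalSmoothing_orbitalSmoothing_le_of_ae_zeroMean`, its `𝔛`-wrapper in flight) delivers a SUP-NORM decay of the doubly smoothed cusp form in the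
reduction-theory weight `w₁ = supHeight` (★ leaf of record `K2E1BLBorelSpacesU2Defs.supHeight`, equal by `rfl` to ★ D5 `K2E1BLSpacesU2Defs.supHeight` used by (R-c)∕(R-d1), §1).
This file is the (short) bridge: **a sup decay `‖ψ(x)‖ ≤ C·w₁(x)^{−m}` a.e. with `m ≥ A` gives `Integrable (w₁^A·‖ψ‖) μ`** on the FINITE automorphic measure, because
`w₁^A·‖ψ‖ ≤ C·w₁^{A−m} ≤ C·c₀^{A−m}` with `c₀ ≤ w₁` (★ `exists_pos_forall_le_supHeight_cm`) — no integrability of any power of `w₁` is used (the dealer's 09:03:54Z caveat), and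
measurability of `w₁` is ★ `measurable_supHeight`.
* §1 `supHeight_eq_supHeight_borel` (`rfl` bridge between the two leaves), `integrable_rpow_supHeight_mul_norm_of_ae_decay` (rank-generic in the hypotheses, CM pair for `c₀`).
* §2 HEAD **`hmean_cm_two_of_cusp_decay (hK1X)`**: «cusp forms have mean zero» — ★ (ρ2)'s letter `hmean` at `U(1,1)_{L∕L⁺}` — MODULO the ONE letter
  `hK1X : ∀ φ ∈ cuspForms μ 𝔓, ∃ C m, 0 ≤ C ∧ A ≤ m ∧ ∀ᵐ x ∂μ, ‖S_η(S_η φ)(x)‖ ≤ C·(eLpNorm φ 2 μ).toReal·w₁(x)^{−m}` (the K1 cusp decay of doubly smoothed cusp forms on `𝔛`, per `φ`, a.e., every height: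
  the payer absorbs the compact part `{w₁ ≤ κ}`), + ★ FILE A's instance letter `ν_G` inversion-invariant.  PAYER OF `hK1X`: the `𝔛`-wrapper of ★ p858893 (K1-L² «(2b)»: `hmass`, Siegel
  normal form, `cmDatum → quasiSplit` transport, ★ p858847 zero means a.e. from the cusp condition).
HONEST LABEL: HC_CM is proved only modulo the 7 printed citations (2 remaining named inputs: hLiu418 = `stmt-HodgeConjecture-24832`, h413 = `stmt-HodgeConjecture-24833`) until rung 0
closes; this file asserts no named fact and closes no socket; letters: `hK1X`, `ν_G`; data `δ, ν, 𝓕, η`.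
References: [BernsteinLapid2019] §4 Claim 5 p. 10 · [MoeglinWaldspurger1995] I.2.13, I.2.18 · [Garrett2018] Thm. 7.3.10 · [GetzHahn2024] Prop. 9.6.1 · [BorelJacquet1979] §4.6.
-/

set_option autoImplicit false
-- the mandated namespace repeats the single-problem summit's segment (`HodgeConjecture.HodgeConjecture`)
set_option linter.dupNamespace false

noncomputable section

open MeasureTheory Measure NumberField IsDedekindDomain Set Filter Module MulAction
open scoped ENNReal NNReal Topology Classical
open Literature.NumberTheory
open Literature.NumberTheory.Automorphic Literature.NumberTheory.Automorphic.UnitaryGroup AdelicGroupData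
open Summit.HodgeConjecture.HodgeConjecture.Cruxes.H413.K2E1BLSpacesU2Defs (supHeight)
open Summit.HodgeConjecture.HodgeConjecture.Cruxes.H413.K2E1BLHeckeOperatorHXU2 (measurable_supHeight)
open Summit.HodgeConjecture.HodgeConjecture.Cruxes.H413.K2E1BLEisensteinInWeightedSpaceU2Weights (exists_pos_forall_le_supHeight_cm)
open Summit.HodgeConjecture.HodgeConjecture.Cruxes.H413.K2E1CuspFormsMeanZeroCMTwo (integral_eq_zero_of_mem_cuspForms_of_smoothing_decay_cm_two continuous_orbitalSmoothing_automorphicQuotient)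

namespace Summit.HodgeConjecture.HodgeConjecture.Cruxes.H413.K2E1CuspFormsMeanZeroOfSupDecayCMTwo

/-! ## §1 The two spellings of `w₁` agree; a sup decay of order `m ≥ A` gives the decay letter of (R-d1) -/

section Generic

variable {F E : Type} [Field F] [NumberField F] [Field E] [NumberField E] [Algebra F E] {c : E ≃ₐ[F] E} {N : ℕ} [NeZero N]

/-- **The two leaves' `supHeight` agree** (★ D5 `K2E1BLSpacesU2Defs.supHeight` = ★ leaf of record `K2E1BLBorelSpacesU2Defs.supHeight`, identical bodies). [cite: BernsteinLapid2019, §4 p. 10] -/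
theorem supHeight_eq_supHeight_borel : supHeight F E c N = K2E1BLBorelSpacesU2Defs.supHeight F E c N := rfl

variable [MeasurableSpace (quasiSplit F E c N).Adelic] [BorelSpace (quasiSplit F E c N).Adelic]

omit [MeasurableSpace (quasiSplit F E c N).Adelic] [BorelSpace (quasiSplit F E c N).Adelic] in
/-- **SUP DECAY ⟹ THE DECAY LETTER.**  `μ` a finite measure on `𝔛`, `w₁ = supHeight ≥ c₀ > 0` everywhere, `ψ` a.e.-strongly measurable with `‖ψ(x)‖ ≤ C·w₁(x)^{−m}` a.e. (`C ≥ 0`), and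
`A ≤ m`: then `w₁^A·‖ψ‖` is `μ`-integrable — it is a.e. bounded by the constant `C·c₀^{A−m}` (`w₁^{A−m} ≤ c₀^{A−m}` as `A − m ≤ 0`) and Borel (★ `measurable_supHeight`).
[cite: BernsteinLapid2019, §4 Claim 5 p. 10] [cite: MoeglinWaldspurger1995, I.2.13] -/
theorem integrable_rpow_supHeight_mul_norm_of_ae_decay {μ : Measure (quasiSplit F E c N).automorphicQuotient} [IsFiniteMeasure μ]
    {c₀ : ℝ≥0} (hc₀ : 0 < c₀) (hwc : ∀ x, c₀ ≤ K2E1BLBorelSpacesU2Defs.supHeight F E c N x)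
    {ψ : (quasiSplit F E c N).automorphicQuotient → ℂ} (hψm : AEStronglyMeasurable ψ μ) {C m A : ℝ} (hC : 0 ≤ C) (hAm : A ≤ m)
    (hdecay : ∀ᵐ x ∂μ, ‖ψ x‖ ≤ C * ((K2E1BLBorelSpacesU2Defs.supHeight F E c N x : ℝ≥0) : ℝ) ^ (-m)) :
    Integrable (fun x => ((supHeight F E c N x : ℝ≥0) : ℝ) ^ A * ‖ψ x‖) μ := by
  rw [supHeight_eq_supHeight_borel]
  have hc₀' : (0 : ℝ) < (c₀ : ℝ) := by exact_mod_cast hc₀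
  have hmeas : AEStronglyMeasurable (fun x => ((K2E1BLBorelSpacesU2Defs.supHeight F E c N x : ℝ≥0) : ℝ) ^ A * ‖ψ x‖) μ :=
    ((measurable_coe_nnreal_real.comp measurable_supHeight).pow_const A).aestronglyMeasurable.mul hψm.norm
  refine Integrable.mono' (integrable_const (C * (c₀ : ℝ) ^ (A - m))) hmeas ?_
  filter_upwards [hdecay] with x hx
  have hw : (c₀ : ℝ) ≤ ((K2E1BLBorelSpacesU2Defs.supHeight F E c N x : ℝ≥0) : ℝ) := by exact_mod_cast hwc x
  have hw0 : (0 : ℝ) < ((K2E1BLBorelSpacesU2Defs.supHeight F E c N x : ℝ≥0) : ℝ) := hc₀'.trans_le hw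
  rw [Real.norm_of_nonneg (mul_nonneg (Real.rpow_nonneg hw0.le _) (norm_nonneg _))]
  calc ((K2E1BLBorelSpacesU2Defs.supHeight F E c N x : ℝ≥0) : ℝ) ^ A * ‖ψ x‖
      ≤ ((K2E1BLBorelSpacesU2Defs.supHeight F E c N x : ℝ≥0) : ℝ) ^ A * (C * ((K2E1BLBorelSpacesU2Defs.supHeight F E c N x : ℝ≥0) : ℝ) ^ (-m)) :=
        mul_le_mul_of_nonneg_left hx (Real.rpow_nonneg hw0.le _)
    _ = C * ((K2E1BLBorelSpacesU2Defs.supHeight F E c N x : ℝ≥0) : ℝ) ^ (A - m) := by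
        rw [sub_eq_add_neg, Real.rpow_add hw0]; ring
    _ ≤ C * (c₀ : ℝ) ^ (A - m) := mul_le_mul_of_nonneg_left (Real.rpow_le_rpow_of_nonpos hc₀' hw (by linarith)) hC

end Generic

/-! ## §2 The head: «cusp forms have mean zero» modulo `hK1X` -/

section CM

variable (L : Type) [Field L] [NumberField L] [IsCMField L]
variable [MeasurableSpace (quasiSplit (↥(maximalRealSubfield L)) L (IsCMField.complexConj L) 2).Adelic] [BorelSpace (quasiSplit (↥(maximalRealSubfield L)) L (IsCMField.complexConj L) 2).Adelic]

/-- **«CUSP FORMS HAVE MEAN ZERO» ON `U(1,1)(L⁺)∖U(1,1)(𝔸_{L⁺})` MODULO THE `𝔛`-SIDE K1 SUP-DECAY LETTER.**  For the CM pair, the capstone binders `δ, ν, 𝓕`, an automorphic `μ`, an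
inversion-invariant Haar `ν_G` (★ FILE A's instance letter), parabolic data `𝔓` with `𝔓.radical i = N(𝔸)`, a test function `η ∈ C_c(G(𝔸))` with `∫η ≠ 0`, an exponent `A > 1`, and
**`hK1X : ∀ φ ∈ cuspForms μ 𝔓, ∃ C m, 0 ≤ C ∧ A ≤ m ∧ ∀ᵐ x ∂μ, ‖S_η(S_η φ)(x)‖ ≤ C·‖φ‖_{L²(μ)}·w₁(x)^{−m}`** (the K1 cusp decay of doubly smoothed cusp forms):
**`∀ φ ∈ cuspForms μ 𝔓, ∫_X φ dμ = 0`** — §1 turns `hK1X` into ★ (R-d1)'s decay letter at `Θ = η` (continuity of `S_η S_η φ` ★ (R-d1) §3), then ★ (R-d1) §4.  With ★ (ρ2)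
`span_const_le_residualSubspace`: the constant line of `L²(𝔛)` is residual, modulo `hK1X`. [cite: MoeglinWaldspurger1995, I.2.18] [cite: BernsteinLapid2019, §4 Claim 5 p. 10]
[cite: BorelJacquet1979, §4.6] -/
theorem hmean_cm_two_of_cusp_decay {δ : L} (hcδ : IsCMField.complexConj L δ = -δ) (hδ : δ ≠ 0)
    (ν : Measure ↥(adelicUnipotent (↥(maximalRealSubfield L)) L (IsCMField.complexConj L) 2)) [ν.IsHaarMeasure] {𝓕 : Set ↥(adelicUnipotent (↥(maximalRealSubfield L)) L (IsCMField.complexConj L) 2)} (h𝓕N : IsFundamentalDomain ↥(rationalUnipotent (↥(maximalRealSubfield L)) L (IsCMField.complexConj L) 2) 𝓕 ν) (h𝓕c : IsCompact (closure 𝓕))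
    (μ : Measure (quasiSplit (↥(maximalRealSubfield L)) L (IsCMField.complexConj L) 2).automorphicQuotient) [(quasiSplit (↥(maximalRealSubfield L)) L (IsCMField.complexConj L) 2).IsAutomorphicMeasure μ] (νG : Measure (quasiSplit (↥(maximalRealSubfield L)) L (IsCMField.complexConj L) 2).Adelic) [νG.IsHaarMeasure] [νG.IsInvInvariant]
    (𝔓 : (quasiSplit (↥(maximalRealSubfield L)) L (IsCMField.complexConj L) 2).ParabolicUnipotentData) (i : 𝔓.ι) (h𝔓 : 𝔓.radical i = adelicUnipotent (↥(maximalRealSubfield L)) L (IsCMField.complexConj L) 2)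
    {η : (quasiSplit (↥(maximalRealSubfield L)) L (IsCMField.complexConj L) 2).Adelic → ℂ} (hη : Continuous η) (hηs : HasCompactSupport η) (hη0 : ∫ g, η g ∂νG ≠ 0) {A : ℝ} (hA : 1 < A)
    (hK1X : ∀ φ ∈ (quasiSplit (↥(maximalRealSubfield L)) L (IsCMField.complexConj L) 2).cuspForms μ 𝔓, ∃ C m : ℝ, 0 ≤ C ∧ A ≤ m ∧ ∀ᵐ x ∂μ,
      ‖orbitalSmoothing νG η (orbitalSmoothing νG η φ) x‖ ≤ C * (eLpNorm φ 2 μ).toReal * (((K2E1BLBorelSpacesU2Defs.supHeight (↥(maximalRealSubfield L)) L (IsCMField.complexConj L) 2 (x)) : ℝ≥0) : ℝ) ^ (-m)) :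
    ∀ φ ∈ (quasiSplit (↥(maximalRealSubfield L)) L (IsCMField.complexConj L) 2).cuspForms μ 𝔓, ∫ x, φ x ∂μ = 0 := by
  intro φ hφ
  obtain ⟨C, m, hC, hAm, hdec⟩ := hK1X φ hφ
  obtain ⟨c₀, hc₀, hwc⟩ := exists_pos_forall_le_supHeight_cm L
  -- `S_η φ ∈ L¹`, `S_η S_η φ` continuous (★ (R-d1) §3, ★ `integrable_orbitalSmoothing`)
  have hφ1 : Integrable φ μ := hφ.2.1.integrable one_le_two
  have h1int : Integrable (orbitalSmoothing νG η φ) μ := by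
    haveI := t2Space_adeleRing_of_numberField L
    haveI := locallyCompactSpace_adeleRing' L
    haveI := secondCountableTopology_adeleRing L
    haveI : T2Space (quasiSplit (↥(maximalRealSubfield L)) L (IsCMField.complexConj L) 2).Adelic := inferInstanceAs (T2Space (adelic (↥(maximalRealSubfield L)) L (IsCMField.complexConj L) 2 ((StdForm.antidiagonal 2).over L)))
    haveI : SecondCountableTopology (quasiSplit (↥(maximalRealSubfield L)) L (IsCMField.complexConj L) 2).Adelic := inferInstanceAs (SecondCountableTopology (adelic (↥(maximalRealSubfield L)) L (IsCMField.complexConj L) 2 ((StdForm.antidiagonal 2).over L)))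
    haveI : LocallyCompactSpace (quasiSplit (↥(maximalRealSubfield L)) L (IsCMField.complexConj L) 2).Adelic := inferInstanceAs (LocallyCompactSpace (adelic (↥(maximalRealSubfield L)) L (IsCMField.complexConj L) 2 ((StdForm.antidiagonal 2).over L)))
    haveI : MeasurableSMul₂ (quasiSplit (↥(maximalRealSubfield L)) L (IsCMField.complexConj L) 2).Adelic (quasiSplit (↥(maximalRealSubfield L)) L (IsCMField.complexConj L) 2).automorphicQuotient := ⟨(continuous_fst.smul continuous_snd).measurable⟩
    exact integrable_orbitalSmoothing μ νG hη hηs hφ1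
  have h2c : Continuous (orbitalSmoothing νG η (orbitalSmoothing νG η φ)) := continuous_orbitalSmoothing_automorphicQuotient μ νG hη hηs h1int
  -- the decay letter of ★ (R-d1) from the sup decay (§1), then ★ (R-d1) §4 at `Θ = η`
  have hsm := integrable_rpow_supHeight_mul_norm_of_ae_decay hc₀ hwc h2c.aestronglyMeasurable (mul_nonneg hC ENNReal.toReal_nonneg) hAm
    (by simpa only [mul_assoc] using hdec)
  exact integral_eq_zero_of_mem_cuspForms_of_smoothing_decay_cm_two L hcδ hδ ν h𝓕N h𝓕c μ νG 𝔓 i h𝔓 hφ hη hηs hη hηs hη0 hη0 hA hsm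

end CM

end Summit.HodgeConjecture.HodgeConjecture.Cruxes.H413.K2E1CuspFormsMeanZeroOfSupDecayCMTwo

end
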